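import Summits.HubbardSuperconductivity.HubbardSuperconductivity.Theorems.AnisotropyChordTransferFibre3FinXDPieces

/-!
# Route `AnisotropyChord` / H0 rotor rung: FIN per-`L` row-D evaluator XD — soundness layer 2b: `Π̂(q₂,q₃)` and `Y_e(q)` on the cell

★ `mem_piHat`: for a key momentum pair, `Π̂(q₂,q₃)` of the ground profile is real and enclosed by `C.piHat` (`piHat_expansion_ground`
+ the scalar / `T` / `G₃` enclosures of `…FinXDPieces` / `…FinXDCellTables`).  ★ `cmem_Y`: `Y_e(q)` is enclosed by `C.Y j q` in the four
directions (`yfun_oneloop` + `WE_neg` / `WE_swap` / `Gres_dirs` + the `W`-table enclosure `mem_Wx`).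
Prover seat `hubbard-h0-rotor-p3` g7; helper for piece A = stmt-HubbardSuperconductivity-23918 of rung 19089 (`--supports`, helper class).
WHAT THIS IS NOT: nothing here proves superconductivity in the Hubbard model (rotor TARGET as worded stays FALSE, g15 verdict); evaluator
soundness for the FIN certificates of ONE conditional reduction.  Tree imports only; no sorry, no new axioms.
-/

set_option linter.dupNamespace false
set_option autoImplicit false

namespace Summit.HubbardSuperconductivity.HubbardSuperconductivity.Theorems.AnisotropyChord.Transfer.Fibre3

namespace FinXD

open scoped BigOperators
open Finset Hole2 FinCell FinXB RowD L2.N1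

section cellPieces

variable {L : ℕ} [NeZero L] {Δ lam2 : ℝ} {f : Tor L → ℝ} {la lb : ℤ} (H : XDHyp (L := L) Δ lam2 f la lb)
include H

/-! ## `Π̂(q₂,q₃)` -/

omit H in
/-- two-propagator sums with a subtracted / doubly shifted momentum are `T`-sums. [folklore] -/
theorem sum_gg_forms (lam : ℝ) (t₂ t₃ : Tor L) :
    (∑ p : Tor L, gres L lam p * gres L lam (p - t₃)) = ∑ p : Tor L, gres L lam p * gres L lam (p + t₃) ∧
    (∑ p : Tor L, gres L lam (p + t₂) * gres L lam (p - t₃)) = ∑ p : Tor L, gres L lam p * gres L lam (p + (t₂ + t₃)) := by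
  constructor
  · rw [show (∑ p : Tor L, gres L lam p * gres L lam (p + t₃)) = ∑ p : Tor L, gres L lam (p + t₃) * gres L lam p from
      Finset.sum_congr rfl (fun p _ => mul_comm _ _)]
    exact Fintype.sum_equiv (Equiv.subRight t₃) _ _ (fun p => by simp)
  · have h := Fintype.sum_equiv (Equiv.addRight t₃) (fun p => gres L lam (p + t₃ + t₂) * gres L lam p)
      (fun p => gres L lam (p + t₂) * gres L lam (p - t₃)) (fun p => by simp [add_right_comm])
    rw [← h]
    refine Finset.sum_congr rfl fun p _ => ?_
    rw [mul_comm, add_assoc, add_comm t₃ t₂]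

/-- ★ `Π̂(q₂,q₃)` is real and its value is enclosed by `C.piHat` (keys: `K ∈ keys3`, so `q₂, q₃, q₂+q₃ ∈ keysQ`). [folklore] -/
theorem mem_piHat {K : (ℤ × ℤ) × (ℤ × ℤ)} (hK : K ∈ keys3) (h1 : K.1 ∈ keysQ) (h2 : K.2 ∈ keysQ)
    (h12 : (K.1.1 + K.2.1, K.1.2 + K.2.2) ∈ keysQ) :
    ∃ x : ℝ, PiHat L f (B1.toTor L K.1) (B1.toTor L K.2) = (x : ℂ) ∧ mem x ((xdC L la lb).piHat K) := by
  have hL5 : 5 ≤ L := by have := H.hL; omega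
  have hV : ((L : ℝ) ^ 2) ≠ 0 := pow_ne_zero 2 (Nat.cast_ne_zero.mpr (NeZero.ne L))
  have hVc : ((L : ℂ) ^ 2) ≠ 0 := pow_ne_zero 2 (Nat.cast_ne_zero.mpr (NeZero.ne L))
  have hexp := piHat_expansion_ground L hL5 H.hΔ0 H.hf (B1.toTor L K.1) (B1.toTor L K.2)
  dsimp only at hexp
  obtain ⟨hE, hBBB⟩ := hexp
  obtain ⟨-, ma, mcs, -, mA, mS1, -⟩ := mem_scalars H
  set a : ℝ := Δ * f (K1 L) with ha
  set cs : ℝ := cS L Δ lam2 f with hcs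
  set A : ℝ := (L : ℝ) ^ 2 + a with hA
  set t₂ := B1.toTor L K.1 with ht₂
  set t₃ := B1.toTor L K.2 with ht₃
  set B : Tor L → ℝ := Bhat L Δ lam2 f with hB
  -- the real expression
  set E : ℝ := A ^ 3 * (if t₂ = 0 then 1 else 0) * (if t₃ = 0 then 1 else 0)
      + A ^ 2 * ((if t₂ = 0 then B t₃ else 0) + (if t₃ = 0 then B t₂ else 0) + (if t₂ + t₃ = 0 then B t₂ else 0))
      + A * (B t₂ * B t₃ + B t₂ * B (t₂ + t₃) + B t₃ * B (t₂ + t₃))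
      + ∑ p : Tor L, B p * B (p + t₂) * B (p - t₃) with hEdef
  refine ⟨E / (L : ℝ) ^ 2, ?_, ?_⟩
  · have : PiHat L f t₂ t₃ = ((E : ℝ) : ℂ) / (L : ℂ) ^ 2 := by
      rw [eq_div_iff hVc, mul_comm, hE]
    rw [this]; push_cast; ring
  -- the enclosure
  have hC := xdC_fields L la lb
  have hz2 := isZ_iff L (xdC L la lb) hC.1 K.1
  have hz3 := isZ_iff L (xdC L la lb) hC.1 K.2
  have hz23 := isZ_iff L (xdC L la lb) hC.1 (K.1.1 + K.2.1, K.1.2 + K.2.2)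
  have h23 : B1.toTor L (K.1.1 + K.2.1, K.1.2 + K.2.2) = t₂ + t₃ := by
    rw [ht₂, ht₃, ← B1.toTor_add]; rfl
  have mB2 := mem_B H K.1
  have mB3 := mem_B H K.2
  have mB23 := mem_B H (K.1.1 + K.2.1, K.1.2 + K.2.2)
  rw [h23] at mB23
  rw [← ht₂] at mB2
  rw [← ht₃] at mB3
  have mT2 := H.mem_T h1
  have mT3 := H.mem_T h2
  have mT23 := H.mem_T h12
  have mG := H.mem_G3 hK
  -- the `T` sums of the expansion
  obtain ⟨f1, f2⟩ := sum_gg_forms (L := L) lam2 t₂ t₃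
  have eT2 : (∑ p : Tor L, gres L lam2 p * gres L lam2 (p + t₂)) = Tq L lam2 K.1 := rfl
  have eT3 : (∑ p : Tor L, gres L lam2 p * gres L lam2 (p - t₃)) = Tq L lam2 K.2 := by rw [f1]; rfl
  have eT23 : (∑ p : Tor L, gres L lam2 (p + t₂) * gres L lam2 (p - t₃)) = Tq L lam2 (K.1.1 + K.2.1, K.1.2 + K.2.2) := by
    rw [f2]; unfold Tq; rw [h23]
  have eG : (∑ p : Tor L, gres L lam2 p * gres L lam2 (p + t₂) * gres L lam2 (p - t₃)) = G3q L lam2 K := rfl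
  rw [eT2, eT3, eT23, eG] at hBBB
  -- assemble
  have hVpos : (0 : ℤ) < (L : ℤ) * L := by
    have : (0 : ℤ) < L := by exact_mod_cast (show 0 < L by omega)
    positivity
  unfold XDCell.piHat
  rw [hC.1]
  have eV : ((L * L : ℕ) : ℝ) = (L : ℝ) ^ 2 := by push_cast; ring
  -- `δ`-terms
  have mite : ∀ (P : Prop) [Decidable P] (b : Bool) (x : ℝ) (I : Iv), (b = true ↔ P) → mem x I →
      mem (if P then x else 0) (if b then I else (0, 0)) := by
    intro P _ b x I hb hx
    by_cases hb' : b = true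
    · rw [if_pos hb', if_pos (hb.mp hb')]; exact hx
    · rw [if_neg hb', if_neg (fun h => hb' (hb.mpr h))]; exact mem_zero
  -- t0
  have hb0 : ((xdC L la lb).isZ K.1 && (xdC L la lb).isZ K.2) = true ↔ (t₂ = 0 ∧ t₃ = 0) := by
    rw [Bool.and_eq_true, hz2, hz3]
  have m0 : mem (A ^ 3 * (if t₂ = 0 then 1 else 0) * (if t₃ = 0 then 1 else 0))
      (if (xdC L la lb).isZ K.1 && (xdC L la lb).isZ K.2 then imul (imul (xdC L la lb).A (xdC L la lb).A) (xdC L la lb).A else (0, 0)) := by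
    have h := mite (t₂ = 0 ∧ t₃ = 0) _ (A * A * A) _ hb0 (mem_imul (mem_imul mA mA) mA)
    have e : A ^ 3 * (if t₂ = 0 then (1 : ℝ) else 0) * (if t₃ = 0 then 1 else 0) = if (t₂ = 0 ∧ t₃ = 0) then A * A * A else 0 := by
      by_cases a2 : t₂ = 0
      · by_cases a3 : t₃ = 0
        · simp [a2, a3]; ring
        · simp [a2, a3]
      · simp [a2]
    rw [e]; exact h
  have m1 := mem_imul (mem_imul mA mA)
    (mem_iadd (mem_iadd (mite (t₂ = 0) _ (B t₃) _ hz2 mB3) (mite (t₃ = 0) _ (B t₂) _ hz3 mB2))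
      (mite (t₂ + t₃ = 0) _ (B t₂) _ (by rw [hz23, h23]) mB2))
  have m2 := mem_imul mA (mem_iadd (mem_iadd (mem_imul mB2 mB3) (mem_imul mB2 mB23)) (mem_imul mB3 mB23))
  have m3 := mem_ineg (mem_iadd (mem_iadd (mem_iadd (mem_iscale (L * L) (mem_imul (mem_imul ma ma) ma))
    (mem_iscale 3 (mem_imul (mem_imul (mem_imul ma ma) mcs) mS1)))
    (mem_imul (mem_imul ma (mem_imul mcs mcs)) (mem_iadd (mem_iadd mT2 mT3) mT23)))
    (mem_imul (mem_imul mcs (mem_imul mcs mcs)) mG))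
  have hsum := mem_idivn (mem_iadd (mem_iadd (mem_iadd m0 m1) m2) m3) hVpos
  have eE : E = A ^ 3 * (if t₂ = 0 then 1 else 0) * (if t₃ = 0 then 1 else 0)
      + A * A * ((if t₂ = 0 then B t₃ else 0) + (if t₃ = 0 then B t₂ else 0) + (if t₂ + t₃ = 0 then B t₂ else 0))
      + A * (B t₂ * B t₃ + B t₂ * B (t₂ + t₃) + B t₃ * B (t₂ + t₃))
      + -(((L * L : ℕ) : ℝ) * (a * a * a) + (3 : ℕ) * (a * a * cs * ∑ p : Tor L, gres L lam2 p)
          + a * (cs * cs) * (Tq L lam2 K.1 + Tq L lam2 K.2 + Tq L lam2 (K.1.1 + K.2.1, K.1.2 + K.2.2))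
          + cs * (cs * cs) * G3q L lam2 K) := by
    rw [hEdef, hBBB]; push_cast; ring
  have ediv : E / (L : ℝ) ^ 2 = E / (((L : ℤ) * L : ℤ) : ℝ) := by push_cast; rw [sq]
  rw [ediv, eE]
  exact hsum

/-! ## `Y_e(q)` -/

/-- ★ `Y_e(q) ∈ C.Y j q` (direction `j < 4`, key momentum `q` with its transpose a key). [folklore] -/
theorem cmem_Y {j : ℕ} (hj : j < 4) {q : ℤ × ℤ} (hq : q ∈ keysQ) (hqT : (q.2, q.1) ∈ keysQ) :
    cmem (Yfun L f (eDir L j) (B1.toTor L q)) ((xdC L la lb).Y j q) := by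
  have hL3 := H.cellHyp.hL3
  have hC := xdC_fields L la lb
  have he : eDir L j ≠ 0 := by
    have hL1 : Fact (1 < L) := ⟨by have := H.hL; omega⟩
    unfold eDir ex ey
    split_ifs <;> simp [Prod.ext_iff]
  have hY := yfun_oneloop L hL3 H.hf.1 H.hlt (eDir L j) (B1.toTor L q) he
  obtain ⟨-, ma, mcs, -, mA, -, -⟩ := mem_scalars H
  -- pieces
  have mph := cmem_phN L hL3 (xdC L la lb) hC.1 hC.2.1 hC.2.2.1 j q
  have monep : cmem (1 + (starRingEnd ℂ) (phase L (B1.toTor L q) (eDir L j))) (cadd (cre ione) ((xdC L la lb).phN j q)) :=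
    cmem_cadd cmem_one mph
  have mB := mem_B H q
  have mdl := mem_dl (L := L) (la := la) (lb := lb) q
  have mgx : mem (Gres L lam2 (eDir L j)) (xdC L la lb).gx := by
    obtain ⟨g1, g2, g3⟩ := Gres_dirs L lam2
    have h := mem_gx H
    unfold eDir
    split_ifs
    · exact h
    · rw [g1]; exact h
    · rw [g2]; exact h
    · rw [g3]; exact h
  -- `W_e(q)` in the four directions
  have mW : cmem (WE L lam2 (eDir L j) (B1.toTor L q)) ((xdC L la lb).W j q) := by
    have w0 : ∀ q' : ℤ × ℤ, Wq L lam2 q' = WE L lam2 (ex L) (B1.toTor L q') := fun q' => rfl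
    have hx : cmem (WE L lam2 (ex L) (B1.toTor L q)) ((xdC L la lb).Wx q) := by rw [← w0]; exact H.mem_Wx hq
    have hxT : cmem (WE L lam2 (ey L) (B1.toTor L q)) ((xdC L la lb).Wx (q.2, q.1)) := by
      rw [WE_swap]
      have e : ((B1.toTor L q).2, (B1.toTor L q).1) = B1.toTor L (q.2, q.1) := rfl
      rw [e, ← w0]; exact H.mem_Wx hqT
    unfold XDCell.W eDir
    interval_cases j
    · simpa using hx
    · simp only [show (1 : ℕ) ≠ 0 from one_ne_zero, if_false, if_true]
      rw [WE_neg]; exact cmem_cconj hx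
    · simpa using hxT
    · simp only [show (3 : ℕ) ≠ 0 by norm_num, show (3 : ℕ) ≠ 1 by norm_num, show (3 : ℕ) ≠ 2 by norm_num, if_false]
      rw [WE_neg]; exact cmem_cconj hxT
  -- the four terms
  set a : ℝ := Δ * f (K1 L) with ha
  set cs : ℝ := cS L Δ lam2 f with hcs
  set A : ℝ := (L : ℝ) ^ 2 + a with hA
  have m1 : cmem ((((A ^ 2 : ℝ)) : ℂ) * (if B1.toTor L q = 0 then (1 : ℂ) else 0))
      (cre (imul (imul (xdC L la lb).A (xdC L la lb).A) ((xdC L la lb).dl q))) := by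
    have h := cmem_cre (mem_imul (mem_imul mA mA) mdl)
    have e : ((((A ^ 2 : ℝ)) : ℂ) * (if B1.toTor L q = 0 then (1 : ℂ) else 0))
        = (((A * A * (if B1.toTor L q = 0 then (1 : ℝ) else 0) : ℝ)) : ℂ) := by
      split_ifs <;> push_cast <;> ring
    rw [e]; exact h
  have m2 : cmem ((((A * Bhat L Δ lam2 f (B1.toTor L q) : ℝ)) : ℂ) * (1 + (starRingEnd ℂ) (phase L (B1.toTor L q) (eDir L j))))
      (cscal (imul (xdC L la lb).A ((xdC L la lb).B q)) (cadd (cre ione) ((xdC L la lb).phN j q))) :=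
    cmem_cscal (mem_imul mA mB) monep
  have m3 : cmem ((((a * cs * ((L : ℝ) ^ 2 * Gres L lam2 (eDir L j)) : ℝ)) : ℂ) * (1 + (starRingEnd ℂ) (phase L (B1.toTor L q) (eDir L j))))
      (cscal (iscale (L * L) (imul (imul (xdC L la lb).a (xdC L la lb).cs) (xdC L la lb).gx)) (cadd (cre ione) ((xdC L la lb).phN j q))) := by
    have h := mem_iscale (L * L) (mem_imul (mem_imul ma mcs) mgx)
    have e : a * cs * ((L : ℝ) ^ 2 * Gres L lam2 (eDir L j)) = ((L * L : ℕ) : ℝ) * (a * cs * Gres L lam2 (eDir L j)) := by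
      push_cast; ring
    rw [e]
    exact cmem_cscal h monep
  have m4 : cmem ((((cs ^ 2 : ℝ)) : ℂ) * (starRingEnd ℂ) (phase L (B1.toTor L q) (eDir L j)) * WE L lam2 (eDir L j) (B1.toTor L q))
      (cscal (imul (xdC L la lb).cs (xdC L la lb).cs) (cmul ((xdC L la lb).phN j q) ((xdC L la lb).W j q))) := by
    rw [mul_assoc, show cs ^ 2 = cs * cs by ring]
    exact cmem_cscal (mem_imul mcs mcs) (cmem_cmul mph mW)
  have msum := cmem_cadd (cmem_cadd (cmem_cadd m1 m2) m3) m4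
  rw [← hY] at msum
  -- divide by `V`
  have hVpos : (0 : ℤ) < (L : ℤ) * L := by
    have : (0 : ℤ) < L := by exact_mod_cast (show 0 < L by omega)
    positivity
  have hre : (((L : ℂ) ^ 2) * Yfun L f (eDir L j) (B1.toTor L q)).re = (Yfun L f (eDir L j) (B1.toTor L q)).re * (((L : ℤ) * L : ℤ) : ℝ) := by
    rw [show ((L : ℂ) ^ 2) = (((L : ℝ) ^ 2 : ℝ) : ℂ) by push_cast; ring, Complex.re_ofReal_mul]; push_cast; ring
  have him : (((L : ℂ) ^ 2) * Yfun L f (eDir L j) (B1.toTor L q)).im = (Yfun L f (eDir L j) (B1.toTor L q)).im * (((L : ℤ) * L : ℤ) : ℝ) := by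
    rw [show ((L : ℂ) ^ 2) = (((L : ℝ) ^ 2 : ℝ) : ℂ) by push_cast; ring, Complex.im_ofReal_mul]; push_cast; ring
  have hVR : (((L : ℤ) * L : ℤ) : ℝ) ≠ 0 := by exact_mod_cast (ne_of_gt hVpos)
  obtain ⟨mr, mi⟩ := msum
  rw [hre] at mr
  rw [him] at mi
  have dr := mem_idivn mr hVpos
  have di := mem_idivn mi hVpos
  rw [mul_div_cancel_right₀ _ hVR] at dr di
  unfold XDCell.Y cmem
  rw [hC.1]
  exact ⟨dr, di⟩

end cellPieces

end FinXD

end Summit.HubbardSuperconductivity.HubbardSuperconductivity.Theorems.AnisotropyChord.Transfer.Fibre3
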